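import Literature.NumberTheory.K2Lit.SiegelEisensteinSeriesDoubled                    -- ★ D2: `siegelDeltaCharacter`, `IsSiegelDeltaSection` (+ GR: `HA`, `hermD`, `IsSiegelDelta`, `detDelta`, `ratH`)
import Literature.NumberTheory.Automorphic.UnitaryGroupDualPairCarriers              -- ★ `adelicInl`, `coe_adelicInl`
import Literature.NumberTheory.Automorphic.IdeleClassGroup                    -- ★ `coe_ideleNorm` (the `ℝ≥0`-valued idele norm hom)
import HarnessLib

/-!
# K2Lit — the Kronecker embedding `U(𝔻) ↪ U(𝔻 ⊗ V′)` between doubled data (DEFS leaf O42.3b-emb)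

Topic `NumberTheory/K2Lit` (Track B, build stream 29; item of record hLiu418 = stmt-HodgeConjecture-24832; steward of socket #42R, SPEC
`SPEC-42R-RoadA-Carriers` S-B, 2026-09-04).  Definitions and proved lemmas only: **no `sorry`, no named fact, no instance, no notation.**

For the Gelbart–Rogawski doubled datum of ★ `DoubledUnitaryGlobalSplittingData` (CM field `L`, frames `dV : Fin N → L`, `dW : Fin M → L`,
enumeration `e : Fin N × Fin M ≃ Fin n`, `𝕍 = V ⊗ W`, `𝔻 = 𝕍 ⊕ (−𝕍)`, `H = U(𝔻)`) and a further diagonal hermitian space `V′` with frame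
`dV′ : Fin M₂ → L`, the space `𝔻 ⊗ V′ = (V ⊗ (W ⊗ V′)) ⊕ −(V ⊗ (W ⊗ V′))` is AGAIN a doubled datum: frames `(dV, dW ⊗ dV′)`, enumerations
`eW : Fin M × Fin M₂ ≃ Fin M′`, `e′ : Fin N × Fin M′ ≃ Fin n′`.  The Weil representation of the dual pair `(U(𝔻), U(V′))` is the `χ`-normalised
doubled Weil representation ★ `IsDoubledWeilRep` of the BIG datum restricted along `h ↦ h ⊗ 1_{V′}`; its Siegel–Weil sections (O42.3b: sections
of hermitian `M₂`-spaces in `I((M₂ − n)/2, ·)`) are ★ `SiegelDoubled.swSection` of the big datum composed with this embedding.  This file types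
the embedding and its Siegel-parabolic bookkeeping:

* `tensorFrame dW dV′ eW : Fin M′ → L` (the frame of `W ⊗ V′`), real and non-degenerate;
* `epsV : Fin n × Fin M₂ ≃ Fin n′`, `epsD : Fin (n+n) × Fin M₂ ≃ Fin (n′+n′)` — the enumerations under which
  **`adelicForm_hermD_tensor`**: `J^{𝔻′}_𝔸 = reindex epsD (J^𝔻_𝔸 ⊗ₖ diag dV′_𝔸)`;
* **`tensorEmb : HA(dV,dW,e) →* HA(dV, tensorFrame, e′)`**, `h ↦ reindex epsD (h ⊗ₖ 1)` (★ `adelicInl` + ★ `reindexU` + cast), `coe_tensorEmb`;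
* `blk_tensorEmb`, **`isSiegelDelta_tensorEmb`** (`P_Δ ↦ P_{Δ ⊗ V′}`), **`deltaBlock_tensorEmb`**, **`detDelta_tensorEmb`** (`det_{Δ′}(h ⊗ 1) = (det_Δ h)^{M₂}`),
  `chiDet_tensorEmb`, `modDelta_tensorEmb`;
* **`siegelDeltaCharacter_tensorEmb`**: `χ′_s(h ⊗ 1) = (χ^{M₂})_{s′}(h)` with `s′ = M₂ s + (M₂ n′ − n)/2` (at the big Siegel–Weil point `s = (1−n′)/2`:
  `s′ = (M₂ − n)/2`, the Siegel–Weil point of an `M₂`-space), hence **`isSiegelDeltaSection_comp_tensorEmb`**: Siegel sections of the big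
  datum restrict along `tensorEmb` to Siegel sections `I(s′, χ^{M₂})` of `H` — with ★ `swSection` (p856173) this types SW sections of `M₂`-spaces.

References: [Kudla1994] §2 (doubled space, Siegel parabolic), §3 Thm. 3.1; [HarrisKudlaSweet1996] §1 (1.8)–(1.16); [GelbartRogawski1991] §3.1–3.2;
[KudlaRallis1994] §1; [Ichino2004] §1.
-/

set_option autoImplicit false

noncomputable section

open NumberField IsDedekindDomain
open scoped Matrix Kronecker

namespace Literature.NumberTheory.K2Lit.SiegelDoubled

open Literature.NumberTheory.Automorphic Literature.NumberTheory.Automorphic.UnitaryGroup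
open Literature.NumberTheory.GelbartRogawski1991 Literature.NumberTheory.GelbartRogawski1991.GRConstruction
open Literature.NumberTheory.GelbartRogawski1991.UnitaryDualPair

variable (L : Type) [Field L] [NumberField L] [IsCMField L]
variable {N M n : ℕ} (e : Fin N × Fin M ≃ Fin n)
  (dV : Fin N → L) (hdV : ∀ i, IsCMField.complexConj L (dV i) = dV i)
  (dW : Fin M → L) (hdW : ∀ i, IsCMField.complexConj L (dW i) = dW i)
variable {M₂ M' n' : ℕ} (eW : Fin M × Fin M₂ ≃ Fin M') (e' : Fin N × Fin M' ≃ Fin n')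
  (dV' : Fin M₂ → L) (hdV' : ∀ k, IsCMField.complexConj L (dV' k) = dV' k)

/-! ## 1. The frame of `W ⊗ V′` and the enumerations -/

omit [NumberField L] [IsCMField L] in
/-- **the frame of `W ⊗ V′`**: `(dW ⊗ dV′)(eW (j, k)) = dW j · dV′ k`. [cite: Kudla1994, §2 (doubled space, Siegel parabolic)] -/
def tensorFrame : Fin M' → L := fun j => dW (eW.symm j).1 * dV' (eW.symm j).2

include hdW hdV' in
/-- the frame of `W ⊗ V′` is real. [cite: Kudla1994, §2 (doubled space, Siegel parabolic)] -/
theorem tensorFrame_real (j : Fin M') : IsCMField.complexConj L (tensorFrame L dW eW dV' j) = tensorFrame L dW eW dV' j := by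
  unfold tensorFrame
  rw [map_mul, hdW, hdV']

omit [NumberField L] [IsCMField L] in
/-- the frame of `W ⊗ V′` is non-degenerate. [cite: Kudla1994, §2 (doubled space, Siegel parabolic)] -/
theorem tensorFrame_ne_zero (hdW0 : ∀ i, dW i ≠ 0) (hdV'0 : ∀ k, dV' k ≠ 0) (j : Fin M') : tensorFrame L dW eW dV' j ≠ 0 :=
  mul_ne_zero (hdW0 _) (hdV'0 _)

/-- **`epsV : Fin n × Fin M₂ ≃ Fin n′`** — `(e (i₁,i₂), k) ↦ e′ (i₁, eW (i₂, k))` (the enumeration of `𝕍 ⊗ V′ = V ⊗ (W ⊗ V′)`).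
[cite: Kudla1994, §2 (doubled space, Siegel parabolic)] -/
def epsV : Fin n × Fin M₂ ≃ Fin n' :=
  ((e.symm.prodCongr (Equiv.refl (Fin M₂))).trans
    ((Equiv.prodAssoc (Fin N) (Fin M) (Fin M₂)).trans ((Equiv.refl (Fin N)).prodCongr eW))).trans e'

omit [Field L] [NumberField L] [IsCMField L] in
/-- `epsV (e (i₁,i₂), k) = e′ (i₁, eW (i₂, k))`. [cite: Kudla1994, §2 (doubled space, Siegel parabolic)] -/
theorem epsV_apply (i : Fin N × Fin M) (k : Fin M₂) :
    epsV e eW e' (e i, k) = e' (i.1, eW (i.2, k)) := by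
  simp [epsV, -finSumFinEquiv_apply_left, -finSumFinEquiv_apply_right]

/-- **`epsD : Fin (n+n) × Fin M₂ ≃ Fin (n′+n′)`** — `𝔻 ⊗ V′ = (𝕍 ⊗ V′) ⊕ (𝕍 ⊗ V′)` blockwise along `e₂`.
[cite: Kudla1994, §2 (doubled space, Siegel parabolic)] -/
def epsD : Fin (n + n) × Fin M₂ ≃ Fin (n' + n') :=
  (((e₂ (n := n)).symm.prodCongr (Equiv.refl (Fin M₂))).trans
    ((Equiv.sumProdDistrib (Fin n) (Fin n) (Fin M₂)).trans ((epsV e eW e').sumCongr (epsV e eW e')))).trans (e₂ (n := n'))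

omit [Field L] [NumberField L] [IsCMField L] in
/-- `epsD (e₂ (inl x), k) = e₂ (inl (epsV (x, k)))`. [cite: Kudla1994, §2 (doubled space, Siegel parabolic)] -/
theorem epsD_inl (x : Fin n) (k : Fin M₂) :
    epsD e eW e' (e₂ (n := n) (Sum.inl x), k) = e₂ (n := n') (Sum.inl (epsV e eW e' (x, k))) := by
  simp [epsD, -finSumFinEquiv_apply_left, -finSumFinEquiv_apply_right]

omit [Field L] [NumberField L] [IsCMField L] in
/-- `epsD (e₂ (inr x), k) = e₂ (inr (epsV (x, k)))`. [cite: Kudla1994, §2 (doubled space, Siegel parabolic)] -/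
theorem epsD_inr (x : Fin n) (k : Fin M₂) :
    epsD e eW e' (e₂ (n := n) (Sum.inr x), k) = e₂ (n := n') (Sum.inr (epsV e eW e' (x, k))) := by
  simp [epsD, -finSumFinEquiv_apply_left, -finSumFinEquiv_apply_right]

/-! ## 2. The Gram identity `J^{𝔻 ⊗ V′} = reindex epsD (J^𝔻 ⊗ₖ diag dV′)` -/

/-- **the hermitian Gram matrix of the big datum is the Kronecker product**, entrywise along `epsD`.
[cite: Kudla1994, §2 (doubled space, Siegel parabolic)] -/
theorem hermD_tensor_apply (a b : Fin (n + n) × Fin M₂) :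
    hermD L e' dV hdV (tensorFrame L dW eW dV') (tensorFrame_real L dW hdW eW dV' hdV') (epsD e eW e' a) (epsD e eW e' b) =
      (hermD L e dV hdV dW hdW ⊗ₖ Matrix.diagonal dV') a b := by
  have hcoe : ∀ z : Fp L, algebraMap (Fp L) L z = (z : L) := fun _ => rfl
  obtain ⟨x, k⟩ := a
  obtain ⟨y, l⟩ := b
  obtain ⟨s, rfl⟩ := (e₂ (n := n)).surjective x
  obtain ⟨t, rfl⟩ := (e₂ (n := n)).surjective y
  rcases s with i | i <;> rcases t with j | j <;>
    obtain ⟨i', rfl⟩ := e.surjective i <;> obtain ⟨j', rfl⟩ := e.surjective j <;>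
    simp only [epsD_inl, epsD_inr, epsV_apply] <;>
    simp [hermD, gramD, gramR, UnitaryDualPair.gram, realDiagonal, tensorFrame, Matrix.kroneckerMap_apply,
      Matrix.diagonal_apply, Matrix.fromBlocks, Matrix.reindex_apply, Matrix.submatrix_apply, Matrix.map_apply,
      eW.injective.eq_iff, Prod.ext_iff, -finSumFinEquiv_apply_left, -finSumFinEquiv_apply_right] <;>
    split_ifs <;> simp_all <;> ring

/-- matrix form: `J^{𝔻⊗V′} = reindex epsD epsD (J^𝔻 ⊗ₖ diag dV′)`. [cite: Kudla1994, §2 (doubled space, Siegel parabolic)] -/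
theorem hermD_tensor :
    hermD L e' dV hdV (tensorFrame L dW eW dV') (tensorFrame_real L dW hdW eW dV' hdV') =
      Matrix.reindex (epsD e eW e') (epsD e eW e') (hermD L e dV hdV dW hdW ⊗ₖ Matrix.diagonal dV') := by
  ext a b
  obtain ⟨a, rfl⟩ := (epsD e eW e').surjective a
  obtain ⟨b, rfl⟩ := (epsD e eW e').surjective b
  rw [Matrix.reindex_apply, Matrix.submatrix_apply, Equiv.symm_apply_apply, Equiv.symm_apply_apply]
  exact hermD_tensor_apply L e dV hdV dW hdW eW e' dV' hdV' a b

/-- adelic form: `J^{𝔻⊗V′}_𝔸 = reindex epsD epsD (J^𝔻_𝔸 ⊗ₖ (diag dV′)_𝔸)`. [cite: Kudla1994, §2 (doubled space, Siegel parabolic)] -/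
theorem adelicForm_hermD_tensor :
    UnitaryGroup.adelicForm L (n' + n') (hermD L e' dV hdV (tensorFrame L dW eW dV') (tensorFrame_real L dW hdW eW dV' hdV')) =
      Matrix.reindex (epsD e eW e') (epsD e eW e')
        (UnitaryGroup.adelicForm L (n + n) (hermD L e dV hdV dW hdW) ⊗ₖ UnitaryGroup.adelicForm L M₂ (Matrix.diagonal dV')) := by
  rw [UnitaryGroup.adelicForm, UnitaryGroup.adelicForm, UnitaryGroup.adelicForm, hermD_tensor L e dV hdV dW hdW eW e' dV' hdV',
    UnitaryGroup.kronecker_map_map]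
  rfl

/-! ## 3. The embedding `h ↦ h ⊗ 1_{V′}` -/

/-- **`tensorEmb : U(𝔻)(𝔸) →* U(𝔻 ⊗ V′)(𝔸)`, `h ↦ reindex epsD (h ⊗ₖ 1)`** (★ `adelicInl`, ★ `reindexU`, cast along `adelicForm_hermD_tensor`).
[cite: Kudla1994, §2 (doubled space, Siegel parabolic), §3 Thm. 3.1] [cite: HarrisKudlaSweet1996, §1 (1.8)] -/
def tensorEmb : HA L e dV hdV dW hdW →* HA L e' dV hdV (tensorFrame L dW eW dV') (tensorFrame_real L dW hdW eW dV' hdV') :=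
  (Subgroup.inclusion (le_of_eq (congrArg (unitaryGroupOfForm (UnitaryGroup.conjAdele (Fp L) L (IsCMField.complexConj L)))
      (adelicForm_hermD_tensor L e dV hdV dW hdW eW e' dV' hdV').symm))).comp <|
    (UnitaryGroup.reindexU _ (epsD e eW e') _).comp
      (UnitaryGroup.adelicInl (Fp L) L (IsCMField.complexConj L) (n + n) M₂ (hermD L e dV hdV dW hdW) (Matrix.diagonal dV'))

/-- the matrix of `tensorEmb h` is `reindex epsD (h ⊗ₖ 1)`. [cite: Kudla1994, §2 (doubled space, Siegel parabolic)] -/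
theorem coe_tensorEmb (h : HA L e dV hdV dW hdW) :
    (((tensorEmb L e dV hdV dW hdW eW e' dV' hdV' h : HA L e' dV hdV (tensorFrame L dW eW dV') (tensorFrame_real L dW hdW eW dV' hdV')) :
        GL (Fin (n' + n')) (AdeleRing (𝓞 L) L)) : Matrix (Fin (n' + n')) (Fin (n' + n')) (AdeleRing (𝓞 L) L)) =
      Matrix.reindex (epsD e eW e') (epsD e eW e')
        ((((h : HA L e dV hdV dW hdW) : GL (Fin (n + n)) (AdeleRing (𝓞 L) L)) : Matrix (Fin (n + n)) (Fin (n + n)) (AdeleRing (𝓞 L) L)) ⊗ₖ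
          (1 : Matrix (Fin M₂) (Fin M₂) (AdeleRing (𝓞 L) L))) := by
  rfl

/-- `tensorEmb` in `GL`: `reindexGL epsD (h ⊗ 1)`. [cite: Kudla1994, §2 (doubled space, Siegel parabolic)] -/
theorem coe_tensorEmb_GL (h : HA L e dV hdV dW hdW) :
    ((tensorEmb L e dV hdV dW hdW eW e' dV' hdV' h : HA L e' dV hdV (tensorFrame L dW eW dV') (tensorFrame_real L dW hdW eW dV' hdV')) :
        GL (Fin (n' + n')) (AdeleRing (𝓞 L) L)) =
      UnitaryGroup.reindexGL (epsD e eW e')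
        ((UnitaryGroup.adelicInl (Fp L) L (IsCMField.complexConj L) (n + n) M₂ (hermD L e dV hdV dW hdW) (Matrix.diagonal dV') h :
          UnitaryGroup.adelicPair (Fp L) L (IsCMField.complexConj L) (n + n) M₂ (hermD L e dV hdV dW hdW) (Matrix.diagonal dV')) :
            GL (Fin (n + n) × Fin M₂) (AdeleRing (𝓞 L) L)) := rfl

/-- `tensorEmb` is continuous. [cite: Kudla1994, §2 (doubled space, Siegel parabolic)] -/
theorem continuous_tensorEmb : Continuous (tensorEmb L e dV hdV dW hdW eW e' dV' hdV') := by
  refine continuous_induced_rng.2 ?_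
  rw [show ((↑) : HA L e' dV hdV (tensorFrame L dW eW dV') (tensorFrame_real L dW hdW eW dV' hdV') → GL (Fin (n' + n')) (AdeleRing (𝓞 L) L)) ∘
      ⇑(tensorEmb L e dV hdV dW hdW eW e' dV' hdV') = fun h => UnitaryGroup.reindexGL (epsD e eW e')
        ((UnitaryGroup.adelicInl (Fp L) L (IsCMField.complexConj L) (n + n) M₂ (hermD L e dV hdV dW hdW) (Matrix.diagonal dV') h :
          UnitaryGroup.adelicPair (Fp L) L (IsCMField.complexConj L) (n + n) M₂ (hermD L e dV hdV dW hdW) (Matrix.diagonal dV')) :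
            GL (Fin (n + n) × Fin M₂) (AdeleRing (𝓞 L) L)) from funext fun h => coe_tensorEmb_GL L e dV hdV dW hdW eW e' dV' hdV' h]
  exact (UnitaryGroup.continuous_reindexGL _).comp (continuous_subtype_val.comp
    (UnitaryGroup.continuous_adelicInl (Fp L) L (IsCMField.complexConj L) (n + n) M₂ (hermD L e dV hdV dW hdW) (Matrix.diagonal dV')))

/-! ## 4. Rational points go to rational points -/

/-- the same embedding on `L⁺`-rational points: `γ ↦ reindex epsD (γ ⊗ₖ 1)` (★ `rationalInl`, ★ `reindexU`, cast along `hermD_tensor`).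
[cite: Kudla1994, §2 (doubled space, Siegel parabolic)] -/
def tensorEmbRat : UnitaryGroup.rational (Fp L) L (IsCMField.complexConj L) (n + n) (hermD L e dV hdV dW hdW) →*
    UnitaryGroup.rational (Fp L) L (IsCMField.complexConj L) (n' + n') (hermD L e' dV hdV (tensorFrame L dW eW dV') (tensorFrame_real L dW hdW eW dV' hdV')) :=
  (Subgroup.inclusion (le_of_eq (congrArg (unitaryGroupOfForm ((IsCMField.complexConj L : L ≃ₐ[Fp L] L) : L →+* L))
      (hermD_tensor L e dV hdV dW hdW eW e' dV' hdV').symm))).comp <|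
    (UnitaryGroup.reindexU _ (epsD e eW e') _).comp
      (UnitaryGroup.rationalInl (Fp L) L (IsCMField.complexConj L) (n + n) M₂ (hermD L e dV hdV dW hdW) (Matrix.diagonal dV'))

/-- **`tensorEmb ∘ toAdelic = toAdelic ∘ tensorEmbRat`**. [cite: Kudla1994, §2 (doubled space, Siegel parabolic)] -/
theorem tensorEmb_toAdelic (γ : UnitaryGroup.rational (Fp L) L (IsCMField.complexConj L) (n + n) (hermD L e dV hdV dW hdW)) :
    tensorEmb L e dV hdV dW hdW eW e' dV' hdV' (UnitaryGroup.toAdelic (Fp L) L (IsCMField.complexConj L) (n + n) (hermD L e dV hdV dW hdW) γ) =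
      UnitaryGroup.toAdelic (Fp L) L (IsCMField.complexConj L) (n' + n') _ (tensorEmbRat L e dV hdV dW hdW eW e' dV' hdV' γ) := by
  apply Subtype.ext
  apply Units.ext
  change Matrix.reindex (epsD e eW e') (epsD e eW e')
      ((((γ : GL (Fin (n + n)) L) : Matrix (Fin (n + n)) (Fin (n + n)) L).map (algebraMap L (AdeleRing (𝓞 L) L))) ⊗ₖ
        (1 : Matrix (Fin M₂) (Fin M₂) (AdeleRing (𝓞 L) L))) =
    (Matrix.reindex (epsD e eW e') (epsD e eW e')
      ((((γ : GL (Fin (n + n)) L) : Matrix (Fin (n + n)) (Fin (n + n)) L)) ⊗ₖ (1 : Matrix (Fin M₂) (Fin M₂) L))).map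
      (algebraMap L (AdeleRing (𝓞 L) L))
  rw [← Matrix.map_one (algebraMap L (AdeleRing (𝓞 L) L)) (map_zero _) (map_one _), UnitaryGroup.kronecker_map_map]
  rfl

/-- **`tensorEmb` carries `H(L⁺)` into `H′(L⁺)`**. [cite: Kudla1994, §2 (doubled space, Siegel parabolic)] -/
theorem tensorEmb_mem_ratH {γ : HA L e dV hdV dW hdW} (hγ : γ ∈ ratH L e dV hdV dW hdW) :
    tensorEmb L e dV hdV dW hdW eW e' dV' hdV' γ ∈ ratH L e' dV hdV (tensorFrame L dW eW dV') (tensorFrame_real L dW hdW eW dV' hdV') := by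
  obtain ⟨γ₀, rfl⟩ := hγ
  exact ⟨_, (tensorEmb_toAdelic L e dV hdV dW hdW eW e' dV' hdV' γ₀).symm⟩

/-! ## 5. Blocks, the Siegel parabolic, `det_Δ` -/

omit [Field L] [NumberField L] [IsCMField L] in
/-- `epsD⁻¹ (e₂ (inl (epsV (x,k)))) = (e₂ (inl x), k)`. [cite: Kudla1994, §2 (doubled space, Siegel parabolic)] -/
theorem epsD_symm_inl (x : Fin n) (k : Fin M₂) :
    (epsD e eW e').symm (e₂ (n := n') (Sum.inl (epsV e eW e' (x, k)))) = (e₂ (n := n) (Sum.inl x), k) :=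
  (Equiv.symm_apply_eq _).2 (epsD_inl e eW e' x k).symm

omit [Field L] [NumberField L] [IsCMField L] in
/-- `epsD⁻¹ (e₂ (inr (epsV (x,k)))) = (e₂ (inr x), k)`. [cite: Kudla1994, §2 (doubled space, Siegel parabolic)] -/
theorem epsD_symm_inr (x : Fin n) (k : Fin M₂) :
    (epsD e eW e').symm (e₂ (n := n') (Sum.inr (epsV e eW e' (x, k)))) = (e₂ (n := n) (Sum.inr x), k) :=
  (Equiv.symm_apply_eq _).2 (epsD_inr e eW e' x k).symm

/-- the `(1,1)` block of `h ⊗ 1` is `h₁₁ ⊗ 1`. [cite: Kudla1994, §2 (doubled space, Siegel parabolic)] -/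
theorem blk_tensorEmb_toBlocks₁₁ (h : HA L e dV hdV dW hdW) :
    (blk L e' dV hdV (tensorFrame L dW eW dV') (tensorFrame_real L dW hdW eW dV' hdV') (tensorEmb L e dV hdV dW hdW eW e' dV' hdV' h)).toBlocks₁₁ =
      Matrix.reindex (epsV e eW e') (epsV e eW e') ((blk L e dV hdV dW hdW h).toBlocks₁₁ ⊗ₖ (1 : Matrix (Fin M₂) (Fin M₂) (AdeleRing (𝓞 L) L))) := by
  ext u v
  obtain ⟨⟨x, k⟩, rfl⟩ := (epsV e eW e').surjective u
  obtain ⟨⟨y, l⟩, rfl⟩ := (epsV e eW e').surjective v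
  simp only [blk, Matrix.toBlocks₁₁, Matrix.reindex_apply, Matrix.submatrix_apply, Matrix.of_apply, Equiv.symm_symm,
    Equiv.symm_apply_apply, coe_tensorEmb, epsD_symm_inl, Matrix.kroneckerMap_apply, Matrix.one_apply]

/-- the `(1,2)` block of `h ⊗ 1` is `h₁₂ ⊗ 1`. [cite: Kudla1994, §2 (doubled space, Siegel parabolic)] -/
theorem blk_tensorEmb_toBlocks₁₂ (h : HA L e dV hdV dW hdW) :
    (blk L e' dV hdV (tensorFrame L dW eW dV') (tensorFrame_real L dW hdW eW dV' hdV') (tensorEmb L e dV hdV dW hdW eW e' dV' hdV' h)).toBlocks₁₂ =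
      Matrix.reindex (epsV e eW e') (epsV e eW e') ((blk L e dV hdV dW hdW h).toBlocks₁₂ ⊗ₖ (1 : Matrix (Fin M₂) (Fin M₂) (AdeleRing (𝓞 L) L))) := by
  ext u v
  obtain ⟨⟨x, k⟩, rfl⟩ := (epsV e eW e').surjective u
  obtain ⟨⟨y, l⟩, rfl⟩ := (epsV e eW e').surjective v
  simp only [blk, Matrix.toBlocks₁₂, Matrix.reindex_apply, Matrix.submatrix_apply, Matrix.of_apply, Equiv.symm_symm,
    Equiv.symm_apply_apply, coe_tensorEmb, epsD_symm_inl, epsD_symm_inr, Matrix.kroneckerMap_apply, Matrix.one_apply]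

/-- the `(2,1)` block of `h ⊗ 1` is `h₂₁ ⊗ 1`. [cite: Kudla1994, §2 (doubled space, Siegel parabolic)] -/
theorem blk_tensorEmb_toBlocks₂₁ (h : HA L e dV hdV dW hdW) :
    (blk L e' dV hdV (tensorFrame L dW eW dV') (tensorFrame_real L dW hdW eW dV' hdV') (tensorEmb L e dV hdV dW hdW eW e' dV' hdV' h)).toBlocks₂₁ =
      Matrix.reindex (epsV e eW e') (epsV e eW e') ((blk L e dV hdV dW hdW h).toBlocks₂₁ ⊗ₖ (1 : Matrix (Fin M₂) (Fin M₂) (AdeleRing (𝓞 L) L))) := by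
  ext u v
  obtain ⟨⟨x, k⟩, rfl⟩ := (epsV e eW e').surjective u
  obtain ⟨⟨y, l⟩, rfl⟩ := (epsV e eW e').surjective v
  simp only [blk, Matrix.toBlocks₂₁, Matrix.reindex_apply, Matrix.submatrix_apply, Matrix.of_apply, Equiv.symm_symm,
    Equiv.symm_apply_apply, coe_tensorEmb, epsD_symm_inl, epsD_symm_inr, Matrix.kroneckerMap_apply, Matrix.one_apply]

/-- the `(2,2)` block of `h ⊗ 1` is `h₂₂ ⊗ 1`. [cite: Kudla1994, §2 (doubled space, Siegel parabolic)] -/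
theorem blk_tensorEmb_toBlocks₂₂ (h : HA L e dV hdV dW hdW) :
    (blk L e' dV hdV (tensorFrame L dW eW dV') (tensorFrame_real L dW hdW eW dV' hdV') (tensorEmb L e dV hdV dW hdW eW e' dV' hdV' h)).toBlocks₂₂ =
      Matrix.reindex (epsV e eW e') (epsV e eW e') ((blk L e dV hdV dW hdW h).toBlocks₂₂ ⊗ₖ (1 : Matrix (Fin M₂) (Fin M₂) (AdeleRing (𝓞 L) L))) := by
  ext u v
  obtain ⟨⟨x, k⟩, rfl⟩ := (epsV e eW e').surjective u
  obtain ⟨⟨y, l⟩, rfl⟩ := (epsV e eW e').surjective v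
  simp only [blk, Matrix.toBlocks₂₂, Matrix.reindex_apply, Matrix.submatrix_apply, Matrix.of_apply, Equiv.symm_symm,
    Equiv.symm_apply_apply, coe_tensorEmb, epsD_symm_inr, Matrix.kroneckerMap_apply, Matrix.one_apply]

/-- **`Δ`-block of `h ⊗ 1`**: `(h ⊗ 1)|_{Δ ⊗ V′} = reindex epsV ((h|_Δ-block) ⊗ 1)`, i.e. `deltaBlock′ (h ⊗ 1) = reindex epsV (deltaBlock h ⊗ₖ 1)`.
[cite: Kudla1994, §2 (doubled space, Siegel parabolic)] [cite: HarrisKudlaSweet1996, §1 (1.11)–(1.12)] -/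
theorem deltaBlock_tensorEmb (h : HA L e dV hdV dW hdW) :
    deltaBlock L e' dV hdV (tensorFrame L dW eW dV') (tensorFrame_real L dW hdW eW dV' hdV') (tensorEmb L e dV hdV dW hdW eW e' dV' hdV' h) =
      Matrix.reindex (epsV e eW e') (epsV e eW e') (deltaBlock L e dV hdV dW hdW h ⊗ₖ (1 : Matrix (Fin M₂) (Fin M₂) (AdeleRing (𝓞 L) L))) := by
  rw [deltaBlock, deltaBlock, blk_tensorEmb_toBlocks₁₁, blk_tensorEmb_toBlocks₁₂, Matrix.add_kronecker, Matrix.reindex_apply,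
    Matrix.reindex_apply, Matrix.reindex_apply, Matrix.submatrix_add, Pi.add_apply, Pi.add_apply]

/-- **`P_Δ ↦ P_{Δ ⊗ V′}`**: `h ∈ P_Δ(𝔸) ⇒ h ⊗ 1 ∈ P_{Δ′}(𝔸)`. [cite: Kudla1994, §2 (doubled space, Siegel parabolic)] [cite: HarrisKudlaSweet1996, §1 (1.11)–(1.12)] -/
theorem isSiegelDelta_tensorEmb {h : HA L e dV hdV dW hdW} (hh : IsSiegelDelta L e dV hdV dW hdW h) :
    IsSiegelDelta L e' dV hdV (tensorFrame L dW eW dV') (tensorFrame_real L dW hdW eW dV' hdV') (tensorEmb L e dV hdV dW hdW eW e' dV' hdV' h) := by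
  unfold IsSiegelDelta at hh ⊢
  have H := congrArg (fun X => Matrix.reindex (epsV e eW e') (epsV e eW e') (X ⊗ₖ (1 : Matrix (Fin M₂) (Fin M₂) (AdeleRing (𝓞 L) L)))) hh
  simp only [Matrix.add_kronecker, Matrix.reindex_apply, Matrix.submatrix_add, Pi.add_apply] at H
  rw [blk_tensorEmb_toBlocks₁₁, blk_tensorEmb_toBlocks₁₂, blk_tensorEmb_toBlocks₂₁, blk_tensorEmb_toBlocks₂₂, Matrix.reindex_apply,
    Matrix.reindex_apply, Matrix.reindex_apply, Matrix.reindex_apply]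
  exact H

/-- **`det_{Δ′}(h ⊗ 1) = (det_Δ h)^{M₂}`**. [cite: Kudla1994, §3 Thm. 3.1] [cite: HarrisKudlaSweet1996, §1 (1.8)] -/
theorem detDelta_tensorEmb (h : HA L e dV hdV dW hdW) :
    detDelta L e' dV hdV (tensorFrame L dW eW dV') (tensorFrame_real L dW hdW eW dV' hdV') (tensorEmb L e dV hdV dW hdW eW e' dV' hdV' h) =
      detDelta L e dV hdV dW hdW h ^ M₂ := by
  rw [detDelta, detDelta, deltaBlock_tensorEmb, Matrix.det_reindex_self, Matrix.det_kronecker, Matrix.det_one, one_pow, mul_one,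
    Fintype.card_fin]

/-- `det_{Δ′}(h ⊗ 1)` is a unit when `det_Δ h` is. [cite: Kudla1994, §3 Thm. 3.1] -/
theorem isUnit_detDelta_tensorEmb {h : HA L e dV hdV dW hdW} (hu : IsUnit (detDelta L e dV hdV dW hdW h)) :
    IsUnit (detDelta L e' dV hdV (tensorFrame L dW eW dV') (tensorFrame_real L dW hdW eW dV' hdV') (tensorEmb L e dV hdV dW hdW eW e' dV' hdV' h)) := by
  rw [detDelta_tensorEmb]
  exact hu.pow _

/-! ## 6. The prescribed scalars: `χ(det_{Δ′}(h ⊗ 1)) = χ(det_Δ h)^{M₂}`, `|det_{Δ′}(h ⊗ 1)|^{1/2} = (|det_Δ h|^{1/2})^{M₂}` -/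

/-- **`χ(det_{Δ′}(h ⊗ 1)) = χ(det_Δ h)^{M₂} = (χ^{M₂})(det_Δ h)`** (for `M₂ ≠ 0`; both sides total).
[cite: Kudla1994, §3 Thm. 3.1] [cite: HarrisKudlaSweet1996, §1 (1.8)] -/
theorem chiDet_tensorEmb (hM₂ : M₂ ≠ 0) (χ : Literature.NumberTheory.GaloisRepresentations.HeckeCharacter L) (h : HA L e dV hdV dW hdW) :
    chiDet L e' dV hdV (tensorFrame L dW eW dV') (tensorFrame_real L dW hdW eW dV' hdV') χ (tensorEmb L e dV hdV dW hdW eW e' dV' hdV' h) =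
      chiDet L e dV hdV dW hdW (χ ^ M₂) h := by
  unfold chiDet
  by_cases hu : IsUnit (detDelta L e dV hdV dW hdW h)
  · have hu' := isUnit_detDelta_tensorEmb L e dV hdV dW hdW eW e' dV' hdV' hu
    have hunit : hu'.unit = hu.unit ^ M₂ :=
      Units.ext (hu'.unit_spec.trans ((detDelta_tensorEmb L e dV hdV dW hdW eW e' dV' hdV' h).trans
        ((congrArg (fun z => z ^ M₂) hu.unit_spec.symm).trans (Units.val_pow_eq_pow_val _ _))))
    rw [dif_pos hu', dif_pos hu, Literature.NumberTheory.GaloisRepresentations.HeckeCharacter.pow_apply, ← map_pow, hunit]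
  · have hu' : ¬ IsUnit (detDelta L e' dV hdV (tensorFrame L dW eW dV') (tensorFrame_real L dW hdW eW dV' hdV')
        (tensorEmb L e dV hdV dW hdW eW e' dV' hdV' h)) := by
      rw [detDelta_tensorEmb]
      exact fun h' => hu ((isUnit_pow_iff hM₂).1 h')
    rw [dif_neg hu', dif_neg hu]

/-- **`|det_{Δ′}(h ⊗ 1)|^{1/2} = (|det_Δ h|^{1/2})^{M₂}`** (for `M₂ ≠ 0`). [cite: Kudla1994, §3 Thm. 3.1] [cite: HarrisKudlaSweet1996, §1 (1.8)] -/
theorem modDelta_tensorEmb (hM₂ : M₂ ≠ 0) (h : HA L e dV hdV dW hdW) :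
    modDelta L e' dV hdV (tensorFrame L dW eW dV') (tensorFrame_real L dW hdW eW dV' hdV') (tensorEmb L e dV hdV dW hdW eW e' dV' hdV' h) =
      modDelta L e dV hdV dW hdW h ^ M₂ := by
  unfold modDelta
  by_cases hu : IsUnit (detDelta L e dV hdV dW hdW h)
  · have hu' := isUnit_detDelta_tensorEmb L e dV hdV dW hdW eW e' dV' hdV' hu
    have hunit : hu'.unit = hu.unit ^ M₂ :=
      Units.ext (hu'.unit_spec.trans ((detDelta_tensorEmb L e dV hdV dW hdW eW e' dV' hdV' h).trans
        ((congrArg (fun z => z ^ M₂) hu.unit_spec.symm).trans (Units.val_pow_eq_pow_val _ _))))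
    rw [dif_pos hu', dif_pos hu, hunit, ← coe_ideleNorm, ← coe_ideleNorm, map_pow, NNReal.coe_pow]
    have h0 : (0 : ℝ) ≤ ((IdeleClassGroup.ideleNorm L hu.unit : NNReal) : ℝ) := NNReal.coe_nonneg _
    rw [show (((IdeleClassGroup.ideleNorm L hu.unit : NNReal) : ℝ)) ^ M₂ =
        (Real.sqrt ((IdeleClassGroup.ideleNorm L hu.unit : NNReal) : ℝ) ^ M₂) ^ 2 by
      rw [← pow_mul, mul_comm, pow_mul, Real.sq_sqrt h0], Real.sqrt_sq (pow_nonneg (Real.sqrt_nonneg _) _)]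
  · have hu' : ¬ IsUnit (detDelta L e' dV hdV (tensorFrame L dW eW dV') (tensorFrame_real L dW hdW eW dV' hdV')
        (tensorEmb L e dV hdV dW hdW eW e' dV' hdV' h)) := by
      rw [detDelta_tensorEmb]
      exact fun h' => hu ((isUnit_pow_iff hM₂).1 h')
    rw [dif_neg hu', dif_neg hu, one_pow]

/-! ## 7. Siegel characters and Siegel sections along `tensorEmb` -/

/-- **`χ′_s(h ⊗ 1) = (χ^{M₂})_{s′}(h)`, `s′ = M₂·s + (M₂·n′ − n)/2`**: the Siegel character of the big datum restricted along `tensorEmb`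
(★ `siegelDeltaCharacter χ s p = χ(det_Δ p)·(|det_Δ p|^{1/2})^{2s+n}`; `M₂ ≠ 0`).  At the big Siegel–Weil point `s = (1 − n′)/2` this is
`s′ = (M₂ − n)/2`. [cite: Kudla1994, §3 Thm. 3.1] [cite: HarrisKudlaSweet1996, §1 (1.8)] [cite: KudlaRallis1994, §1] -/
theorem siegelDeltaCharacter_tensorEmb (hM₂ : M₂ ≠ 0) (χ : Literature.NumberTheory.GaloisRepresentations.HeckeCharacter L) (s : ℂ)
    (h : HA L e dV hdV dW hdW) :
    siegelDeltaCharacter L e' dV hdV (tensorFrame L dW eW dV') (tensorFrame_real L dW hdW eW dV' hdV') χ s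
        (tensorEmb L e dV hdV dW hdW eW e' dV' hdV' h) =
      siegelDeltaCharacter L e dV hdV dW hdW (χ ^ M₂) ((M₂ : ℂ) * s + ((M₂ : ℂ) * (n' : ℂ) - (n : ℂ)) / 2) h := by
  have h0 : 0 < modDelta L e dV hdV dW hdW h := modDelta_pos L e dV hdV dW hdW h
  have harg : ((modDelta L e dV hdV dW hdW h : ℝ) : ℂ).arg = 0 := Complex.arg_ofReal_of_nonneg h0.le
  rw [siegelDeltaCharacter, siegelDeltaCharacter, chiDet_tensorEmb L e dV hdV dW hdW eW e' dV' hdV' hM₂,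
    modDelta_tensorEmb L e dV hdV dW hdW eW e' dV' hdV' hM₂, Complex.ofReal_pow,
    ← Complex.cpow_nat_mul' (by rw [harg, mul_zero]; exact neg_lt_zero.2 Real.pi_pos) (by rw [harg, mul_zero]; exact Real.pi_pos.le)]
  congr 2
  ring

/-- **Siegel sections restrict along `tensorEmb`**: `φ ∈ I′(s, χ)` (big datum) ⇒ `φ ∘ tensorEmb ∈ I(M₂ s + (M₂ n′ − n)/2, χ^{M₂})`.  With ★
`isSiegelDeltaSection_swSection` (big datum, `s = (1−n′)/2`) this gives the SIEGEL–WEIL SECTIONS OF AN `M₂`-SPACE `V′` in `I((M₂ − n)/2, χ^{M₂})`.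
[cite: KudlaRallis1994, §1] [cite: HarrisKudlaSweet1996, §1 (1.15)–(1.16)] [cite: Kudla1994, §3 Thm. 3.1] -/
theorem isSiegelDeltaSection_comp_tensorEmb (hM₂ : M₂ ≠ 0) {χ : Literature.NumberTheory.GaloisRepresentations.HeckeCharacter L} {s : ℂ}
    {φ : HA L e' dV hdV (tensorFrame L dW eW dV') (tensorFrame_real L dW hdW eW dV' hdV') → ℂ}
    (hφ : IsSiegelDeltaSection L e' dV hdV (tensorFrame L dW eW dV') (tensorFrame_real L dW hdW eW dV' hdV') χ s φ) :
    IsSiegelDeltaSection L e dV hdV dW hdW (χ ^ M₂) ((M₂ : ℂ) * s + ((M₂ : ℂ) * (n' : ℂ) - (n : ℂ)) / 2)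
      (fun h => φ (tensorEmb L e dV hdV dW hdW eW e' dV' hdV' h)) := by
  intro p hp h
  show φ (tensorEmb L e dV hdV dW hdW eW e' dV' hdV' (p * h)) = _ * φ (tensorEmb L e dV hdV dW hdW eW e' dV' hdV' h)
  rw [map_mul, hφ _ (isSiegelDelta_tensorEmb L e dV hdV dW hdW eW e' dV' hdV' hp), siegelDeltaCharacter_tensorEmb L e dV hdV dW hdW eW e' dV' hdV' hM₂]

end Literature.NumberTheory.K2Lit.SiegelDoubled

end
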